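import Literature.Analysis.FluidPDE.ExtremeGrowthSupNormAPriori
import Literature.Analysis.FluidPDE.AdditiveNoiseMeasurePreserving
import Literature.Analysis.FunctionSpaces.TorusSpaceTimeCutoff

/-!
# Material displacement budget along classical Navier–Stokes solutions on `T³`
(pub-fluidc cell, R2 rung, CARD O6 "Córdoba–Fefferman displacement price": targets T-O6a AND
T-O6b; mathematics and Lean by seat idea-2 gen 5 (`HOME/pub-fluidc-idea-2/SKETCH-R2-displacement.lean`,
sha16 4ed77e13ccdfb89f), landed def-free with the budget-window corollary by seat p2 gen 2)

HONEST FRAMING: low prior, high value-of-information experiment on Tao's machine paradigm;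
NOT a claim that NS blows up.

What is proved (sorry-free, against the tree's Foias–Guillopé–Temam file
`Literature.Analysis.FluidPDE.ExtremeGrowthSupNormAPriori`):

* `norm_sub_le_primitive_sub` — generic fencing: a path `Y` with one-sided derivative `V` within
  `[a, b]` and `‖V t‖ ≤ w t`, where `P' = w` within `[a, b]`, moves at most `P t − P a`.
* `material_displacement_le_fgtSupPrimitive_sub` — along a classical mean-zero solution of the
  unforced Navier–Stokes equations on `T³` (`ν > 0`) on `[a, b]`, ANY path whose speed is at each
  time bounded by the fluid speed at some point (e.g. the `ℝ³`-lift of a particle trajectory,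
  `V t = u t (X t)`) satisfies `‖Y t − Y a‖ ≤ P(t) − P(a)` with `P = fgtSupPrimitive ν u`
  (Córdoba–Fefferman–de la Llave 2004 / Lemarié-Rieusset §11.7 (11.64): the `L¹_t L^∞_x` bound
  caps how far material points travel — "no squirt singularities", budget form).
* `material_displacement_le_fgt_budget` — the uniform form
  `‖Y t − Y a‖ ≤ α_ν + β (b − a) + (γ_ν/ν) K(u(a))` (explicit constants of the tree file).
* `displacementBudget_fgt` — the displacement functional `D t₀ t := P t − P t₀` is bounded by the
  FGT constant for `a ≤ t < b` (the shape `DisplacementBudget D a b B` of the cell's card O6,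
  stated unfolded here; it is the hypothesis `hbud` of the card's `volume_ge_of_budget`).
* `measure_window_le_of_materialTransport`, `cfWindowInequality_of_flow` — the KINEMATIC lemma
  T-O6a in abstract form, PROVED: for a measure-preserving flow map with height displacement
  `≤ D` transporting `Ω₁` into `Ω₂`, `μ(Ω₂ ∩ {a ≤ h₃ ≤ b}) ≥ μ(Ω₁ ∩ {a + D ≤ h₃ ≤ b − D})`
  (Córdoba–Fefferman 2001 §5 (31)–(33)); hence the card's window inequality
  `V t₁ (a + D t₁ t₂) (b − D t₁ t₂) ≤ V t₂ a b` (shape `CFWindowInequality V D`, stated unfolded)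
  for the window volumes of any material region (no invertibility or measurability needed).
* `torus_material_window_le`, `torus_noMaterialCollapse` — the `T³` Navier–Stokes theorems: the
  Lagrangian flow of a classical mean-zero solution (the tree's
  `Torus.exists_measurePreserving_noisyFlow` with ZERO noise: Picard–Lindelöf + Liouville) is
  volume preserving, moves every particle by at most `P(t) − P(a) ≤ α_ν + β(b−a) + (γ_ν/ν)K(u(a))`,
  and satisfies the Córdoba–Fefferman window inequality for EVERY material region `φ_t(Ω₀)` and
  EVERY `1`-Lipschitz observable `g : T³ → ℝ` (CF's regular tube = the case `g` = height in a
  chart); `torus_material_window_le_budget` is the same with the uniform FGT budget `B` in place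
  of `D` (valid since `D ≤ B` shrinks the inner window) — "no material tube collapse on `T³`" with
  an explicit floor. Nothing is assumed beyond the classical solution.

References: [CordobaFefferman2001, §5 (29)–(34)]; Córdoba–Fefferman–de la Llave 2004 (SIAM J. Math.
Anal. 36, 204–213, doi:10.1137/s0036141003424095); [FoiasGuillopeTemam1981] via the tree file;
[RobinsonRodrigoSadowski2016, Lemma 8.15]; the flow package [JohanssonSorella2024] tree file
`AdditiveNoiseMeasurePreserving`. HONEST FRAMING as above. No definitions are introduced.
-/

noncomputable section

open Set

namespace Summit.NavierStokesRegularity.FluidComputer.MaterialDisplacement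

open Literature.Analysis.FluidPDE Literature.Analysis.FunctionSpaces

section Generic

variable {E : Type*} [NormedAddCommGroup E] [NormedSpace ℝ E]

/-- Generic fencing lemma: if `Y` has one-sided derivative `V t` within `[a, b]`, `P` has
derivative `w t` within `[a, b]`, and `‖V t‖ ≤ w t` on `[a, b]`, then `‖Y t − Y a‖ ≤ P t − P a`
for every `t ∈ [a, b]` (Mathlib `image_norm_le_of_norm_deriv_right_le_deriv_boundary'`). -/
theorem norm_sub_le_primitive_sub {Y V : ℝ → E} {P w : ℝ → ℝ} {a b : ℝ}
    (hY : ∀ t ∈ Icc a b, HasDerivWithinAt Y (V t) (Icc a b) t)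
    (hP : ∀ t ∈ Icc a b, HasDerivWithinAt P (w t) (Icc a b) t)
    (hVw : ∀ t ∈ Icc a b, ‖V t‖ ≤ w t) {t : ℝ} (ht : t ∈ Icc a b) :
    ‖Y t - Y a‖ ≤ P t - P a := by
  have hf : ContinuousOn (fun s => Y s - Y a) (Icc a b) :=
    fun s hs => ((hY s hs).continuousWithinAt).sub continuousWithinAt_const
  have hf' : ∀ s ∈ Ico a b, HasDerivWithinAt (fun s => Y s - Y a) (V s) (Ici s) s :=
    fun s hs => ((hY s (Ico_subset_Icc_self hs)).sub_const (Y a)).mono_of_mem_nhdsWithin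
      (Icc_mem_nhdsGE_of_mem hs)
  have hB : ContinuousOn (fun s => P s - P a) (Icc a b) :=
    fun s hs => ((hP s hs).continuousWithinAt).sub continuousWithinAt_const
  have hB' : ∀ s ∈ Ico a b, HasDerivWithinAt (fun s => P s - P a) (w s) (Ici s) s :=
    fun s hs => ((hP s (Ico_subset_Icc_self hs)).sub_const (P a)).mono_of_mem_nhdsWithin
      (Icc_mem_nhdsGE_of_mem hs)
  have ha : ‖Y a - Y a‖ ≤ P a - P a := by simp
  exact image_norm_le_of_norm_deriv_right_le_deriv_boundary' hf hf' ha hB hB'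
    (fun s hs => hVw s (Ico_subset_Icc_self hs)) ht

end Generic

section Kinematic

open MeasureTheory

variable {α : Type*} [MeasurableSpace α]

/-- **Córdoba–Fefferman window inequality, abstract form** (CF 2001 §5, (31)–(33), PROVED):
if `Φ` is a measure-preserving map (the flow map between two times; no invertibility needed)
whose "height" displacement is at most `D` (`|h₃ (Φ x) − h₃ x| ≤ D`, `h₃` any real observable —
for a regular tube the `x₃`-coordinate in a chart, on `T³` any `1`-Lipschitz observable) and the
region `Ω₂` contains the transport of `Ω₁` (`Φ '' Ω₁ ⊆ Ω₂`: MATERIAL), then the measure of `Ω₂`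
inside the window `a ≤ h₃ ≤ b` is at least the measure of `Ω₁` inside the shrunken window
`a + D ≤ h₃ ≤ b − D`. (Uses only `μ S ≤ μ (Φ⁻¹(Φ S)) ≤ (Φ_* μ)(Φ S) = μ (Φ S)`, Mathlib
`Measure.le_map_apply`, so no measurability of the sets is required.)
[Córdoba–Fefferman 2001, §5, (31)–(33)] -/
theorem measure_window_le_of_materialTransport (μ : Measure α) {Φ : α → α}
    (hΦ : MeasurePreserving Φ μ μ) (h₃ : α → ℝ) {D a b : ℝ}
    (hdisp : ∀ x, |h₃ (Φ x) - h₃ x| ≤ D) {Ω₁ Ω₂ : Set α} (hmat : Φ '' Ω₁ ⊆ Ω₂) :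
    μ (Ω₁ ∩ {x | a + D ≤ h₃ x ∧ h₃ x ≤ b - D}) ≤ μ (Ω₂ ∩ {x | a ≤ h₃ x ∧ h₃ x ≤ b}) := by
  set S : Set α := Ω₁ ∩ {x | a + D ≤ h₃ x ∧ h₃ x ≤ b - D} with hS
  have hsub : Φ '' S ⊆ Ω₂ ∩ {x | a ≤ h₃ x ∧ h₃ x ≤ b} := by
    rintro _ ⟨x, ⟨hxΩ, hxa, hxb⟩, rfl⟩
    have h1 := (abs_le.1 (hdisp x)).1
    have h2 := (abs_le.1 (hdisp x)).2
    exact ⟨hmat ⟨x, hxΩ, rfl⟩, by linarith, by linarith⟩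
  calc μ S ≤ μ (Φ ⁻¹' (Φ '' S)) := measure_mono (subset_preimage_image Φ S)
    _ ≤ μ.map Φ (Φ '' S) := Measure.le_map_apply hΦ.measurable.aemeasurable _
    _ = μ (Φ '' S) := by rw [hΦ.map_eq]
    _ ≤ μ (Ω₂ ∩ {x | a ≤ h₃ x ∧ h₃ x ≤ b}) := measure_mono hsub

/-- **T-O6a reduced to the flow-map package (PROVED).** Given a finite measure, a height
observable `h₃`, a time-indexed region `Ω t` that is MATERIAL for a two-time family of
measure-preserving flow maps `Φ t₁ t₂` (`Φ t₁ t₂ '' Ω t₁ ⊆ Ω t₂`) whose height displacement is at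
most `D t₁ t₂`, the window-volume function `V t a b := μ(Ω t ∩ {a ≤ h₃ ≤ b})` satisfies the
card's window inequality `V t₁ (a + D t₁ t₂) (b − D t₁ t₂) ≤ V t₂ a b` for `t₁ ≤ t₂` (the shape
`CFWindowInequality V D` of card O6, unfolded; the side condition `a + 2 D ≤ b` of the card is not
even needed). For Navier–Stokes on `T³`: `μ` = volume, `Φ` = the Lagrangian flow
(measure-preserving by Liouville, cf. the tree's `AdditiveNoiseMeasurePreserving.lean` /
`ODE.LiouvilleFormula`), and `D t₁ t₂ = P t₂ − P t₁` by
`material_displacement_le_fgtSupPrimitive_sub`. [Córdoba–Fefferman 2001, §5, (29)–(34)] -/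
theorem cfWindowInequality_of_flow (μ : Measure α) [IsFiniteMeasure μ] (h₃ : α → ℝ)
    (Ω : ℝ → Set α) (Φ : ℝ → ℝ → α → α) (D : ℝ → ℝ → ℝ)
    (hΦ : ∀ t₁ t₂, t₁ ≤ t₂ → MeasurePreserving (Φ t₁ t₂) μ μ)
    (hmat : ∀ t₁ t₂, t₁ ≤ t₂ → Φ t₁ t₂ '' Ω t₁ ⊆ Ω t₂)
    (hdisp : ∀ t₁ t₂, t₁ ≤ t₂ → ∀ x, |h₃ (Φ t₁ t₂ x) - h₃ x| ≤ D t₁ t₂)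
    {t₁ t₂ : ℝ} (ht : t₁ ≤ t₂) (a b : ℝ) :
    (μ (Ω t₁ ∩ {x | a + D t₁ t₂ ≤ h₃ x ∧ h₃ x ≤ b - D t₁ t₂})).toReal ≤
      (μ (Ω t₂ ∩ {x | a ≤ h₃ x ∧ h₃ x ≤ b})).toReal :=
  ENNReal.toReal_mono (measure_ne_top μ _)
    (measure_window_le_of_materialTransport μ (hΦ t₁ t₂ ht) h₃ (hdisp t₁ t₂ ht) (hmat t₁ t₂ ht))

end Kinematic

section NavierStokes

variable {d : Type*} [Fintype d] [DecidableEq d]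
variable {ν a b : ℝ} {u : ℝ → UnitAddTorus d → EuclideanSpace ℝ d} {p : ℝ → UnitAddTorus d → ℝ}
variable {E : Type*} [NormedAddCommGroup E] [NormedSpace ℝ E]

/-- **Material displacement, primitive form.** Along a classical mean-zero solution of the
unforced Navier–Stokes equations on `T³` (`ν > 0`) on `[a, b]`, a path `Y` (in any real normed
space — e.g. the `ℝ³`-lift of a fluid-particle trajectory) whose one-sided velocity `V t` is
bounded in norm by the fluid speed at some point `x_t` for every `t` travels at most
`P(t) − P(a)`, `P = fgtSupPrimitive ν u` (whose derivative is the pointwise sup majorant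
`fgtSupBound`). [Córdoba–Fefferman–de la Llave 2004; Lemarié-Rieusset, §11.7, (11.64);
Foias–Guillopé–Temam 1981 via `norm_le_fgtSupBound`, `hasDerivWithinAt_fgtSupPrimitive`] -/
theorem material_displacement_le_fgtSupPrimitive_sub (hd : Fintype.card d = 3) (hν : 0 < ν)
    (hab : a < b) (h : Torus.IsClassicalNSSolutionOn (Icc a b) ν 0 u p)
    (hmean : ∀ t ∈ Icc a b, Torus.HasZeroMean (u t))
    {Y V : ℝ → E} (hY : ∀ t ∈ Icc a b, HasDerivWithinAt Y (V t) (Icc a b) t)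
    (hV : ∀ t ∈ Icc a b, ∃ x, ‖V t‖ ≤ ‖u t x‖) {t : ℝ} (ht : t ∈ Icc a b) :
    ‖Y t - Y a‖ ≤ fgtSupPrimitive ν u t - fgtSupPrimitive ν u a := by
  refine norm_sub_le_primitive_sub hY
    (fun s hs => hasDerivWithinAt_fgtSupPrimitive hν hab h hs) (fun s hs => ?_) ht
  obtain ⟨x, hx⟩ := hV s hs
  exact hx.trans (norm_le_fgtSupBound hd hν (h.smooth_velocity.isSmooth_slice hs) (hmean s hs) x)

/-- **Material displacement, uniform form** (the FGT budget with the tree's explicit constants):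
`‖Y t − Y a‖ ≤ α_ν + β (b − a) + (γ_ν/ν) K(u(a))` for all `t ∈ [a, b]`.
[Foias–Guillopé–Temam 1981; Robinson–Rodrigo–Sadowski 2016, Lemma 8.15, (8.7), via
`fgtSupPrimitive_sub_le`] -/
theorem material_displacement_le_fgt_budget (hd : Fintype.card d = 3) (hν : 0 < ν)
    (hab : a < b) (h : Torus.IsClassicalNSSolutionOn (Icc a b) ν 0 u p)
    (hmean : ∀ t ∈ Icc a b, Torus.HasZeroMean (u t))
    {Y V : ℝ → E} (hY : ∀ t ∈ Icc a b, HasDerivWithinAt Y (V t) (Icc a b) t)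
    (hV : ∀ t ∈ Icc a b, ∃ x, ‖V t‖ ≤ ‖u t x‖) {t : ℝ} (ht : t ∈ Icc a b) :
    ‖Y t - Y a‖ ≤ fgtRateCoeff ν + fgtConstCoeff * (b - a) +
      fgtGradCoeff ν / ν * Torus.kineticEnergy (u a) :=
  (material_displacement_le_fgtSupPrimitive_sub hd hν hab h hmean hY hV ht).trans
    (fgtSupPrimitive_sub_le hν ht)

/-- **The FGT instance of the budget**: with `D t₀ t := P t − P t₀` (the primitive increment, a
majorant of `∫_{t₀}^{t} sup_x ‖u‖` and of every material displacement by the theorem above),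
`D a t ≤ α_ν + β (b − a) + (γ_ν/ν) K(u(a))` for `a ≤ t < b` — the shape
`DisplacementBudget D a b B` of card O6 (hypothesis `hbud` of its `volume_ge_of_budget`), unfolded.
[Foias–Guillopé–Temam 1981 via `fgtSupPrimitive_sub_le`] -/
theorem displacementBudget_fgt (hν : 0 < ν) (t : ℝ) (hat : a ≤ t) (htb : t < b) :
    fgtSupPrimitive ν u t - fgtSupPrimitive ν u a ≤
      fgtRateCoeff ν + fgtConstCoeff * (b - a) + fgtGradCoeff ν / ν * Torus.kineticEnergy (u a) :=
  fgtSupPrimitive_sub_le hν ⟨hat, htb.le⟩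

/-- Nonnegativity of the FGT displacement functional on ordered times inside the window
(`P` is nondecreasing since `P' = fgtSupBound ≥ ‖u t x‖ ≥ 0`) — the hypothesis `hD` of
`volume_ge_of_budget`. -/
theorem fgt_displacement_nonneg (hd : Fintype.card d = 3) (hν : 0 < ν) (hab : a < b)
    (h : Torus.IsClassicalNSSolutionOn (Icc a b) ν 0 u p)
    (hmean : ∀ t ∈ Icc a b, Torus.HasZeroMean (u t)) {t : ℝ} (ht : t ∈ Icc a b) :
    0 ≤ fgtSupPrimitive ν u t - fgtSupPrimitive ν u a := by
  have h0 := material_displacement_le_fgtSupPrimitive_sub (E := ℝ) hd hν hab h hmean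
    (Y := fun _ => (0 : ℝ)) (V := fun _ => (0 : ℝ))
    (fun s _ => hasDerivWithinAt_const s (Icc a b) (0 : ℝ))
    (fun s hs => ⟨(0 : UnitAddTorus d), by simp⟩) ht
  simpa using h0

end NavierStokes

section TorusMaterial

open MeasureTheory Literature.Analysis.FunctionSpaces.Torus

variable {d : Type*} [Fintype d] [DecidableEq d]
variable {ν a b : ℝ} {u : ℝ → UnitAddTorus d → EuclideanSpace ℝ d} {p : ℝ → UnitAddTorus d → ℝ}

/-- **Material window inequality on `T³` along Navier–Stokes, given the Lagrangian flow data**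
(PROVED). Let `(u, p)` be a classical mean-zero solution of the unforced Navier–Stokes equations
on `T³` (`ν > 0`) on `[a, b]`, and let `Y`, `φ` be Lagrangian flow data started at time `a`
(lifted trajectories `Y y` solving `Ẏ = u(s, proj Y)` with `Y y a = y`, torus maps `φ s` with
`φ s (proj y) = proj (Y y s)`, each `φ s` volume preserving — exactly what the tree's
`Torus.exists_measurePreserving_noisyFlow` produces with zero noise). Then for EVERY region `Ω₀`,
every `1`-Lipschitz observable `g : T³ → ℝ`, all levels `a' ≤ b'` and every `t ∈ [a, b]`:
`vol(φ_t(Ω₀) ∩ {a' ≤ g ≤ b'}) ≥ vol(Ω₀ ∩ {a' + D ≤ g ≤ b' − D})` with the FGT displacement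
`D = P(t) − P(a)`, `P = fgtSupPrimitive ν u`. (Córdoba–Fefferman's statement is the case of a
regular tube and `g` = the height coordinate in its chart.)
[Córdoba–Fefferman 2001 §5; Córdoba–Fefferman–de la Llave 2004; Foias–Guillopé–Temam 1981] -/
theorem torus_material_window_le (hd : Fintype.card d = 3) (hν : 0 < ν) (hab : a < b)
    (h : Torus.IsClassicalNSSolutionOn (Icc a b) ν 0 u p)
    (hmean : ∀ t ∈ Icc a b, Torus.HasZeroMean (u t))
    {Y : EuclideanSpace ℝ d → ℝ → EuclideanSpace ℝ d} {φ : ℝ → UnitAddTorus d → UnitAddTorus d}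
    (hY0 : ∀ y, Y y a = y)
    (hY : ∀ y, ∀ s ∈ Icc a b, HasDerivWithinAt (Y y) (lift (u s) (Y y s)) (Icc a b) s)
    (hφ : ∀ s ∈ Icc a b, ∀ y, φ s (proj y) = proj (Y y s))
    (hφmp : ∀ s ∈ Icc a b, MeasurePreserving (φ s) volume volume)
    (Ω₀ : Set (UnitAddTorus d)) {g : UnitAddTorus d → ℝ} (hg : LipschitzWith 1 g) (a' b' : ℝ)
    {t : ℝ} (ht : t ∈ Icc a b) :
    volume (Ω₀ ∩ {x | a' + (fgtSupPrimitive ν u t - fgtSupPrimitive ν u a) ≤ g x ∧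
        g x ≤ b' - (fgtSupPrimitive ν u t - fgtSupPrimitive ν u a)}) ≤
      volume (φ t '' Ω₀ ∩ {x | a' ≤ g x ∧ g x ≤ b'}) := by
  refine measure_window_le_of_materialTransport volume (hφmp t ht) g (fun x => ?_) subset_rfl
  obtain ⟨y, rfl⟩ := proj_surjective x
  have hdispY : ‖Y y t - Y y a‖ ≤ fgtSupPrimitive ν u t - fgtSupPrimitive ν u a :=
    material_displacement_le_fgtSupPrimitive_sub hd hν hab h hmean (hY y)
      (fun s _ => ⟨proj (Y y s), le_rfl⟩) ht
  rw [hφ t ht y, hY0 y] at *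
  calc |g (proj (Y y t)) - g (proj y)| = dist (g (proj (Y y t))) (g (proj y)) := (Real.dist_eq _ _).symm
    _ ≤ 1 * dist (proj (Y y t)) (proj y) := hg.dist_le_mul _ _
    _ = dist (proj (Y y t)) (proj y) := one_mul _
    _ ≤ ‖Y y t - y‖ := dist_proj_proj_le _ _
    _ ≤ fgtSupPrimitive ν u t - fgtSupPrimitive ν u a := hdispY

/-- **Material window inequality on `T³` with the uniform FGT budget** (T-O6b, "no material tube
collapse with an explicit floor"): in the setting of `torus_material_window_le`, for every region
`Ω₀`, every `1`-Lipschitz observable `g`, all levels `a', b'` and every `t ∈ [a, b]`,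
`vol(Ω₀ ∩ {a' + B ≤ g ≤ b' − B}) ≤ vol(φ_t(Ω₀) ∩ {a' ≤ g ≤ b'})` with the time-uniform budget
`B = α_ν + β (b − a) + (γ_ν/ν) K(u(a))` — because the FGT displacement `D(t) ≤ B` only shrinks the
inner window. In particular a material region holding volume `m` inside `[a' + B, b' − B]` at time
`a` holds volume `≥ m` inside `[a', b']` at all later times of the interval (Córdoba–Fefferman's
non-collapse of regular tubes, quantitative, on `T³`).
[CordobaFefferman2001 §5; Foias–Guillopé–Temam 1981; Robinson–Rodrigo–Sadowski 2016 Lemma 8.15] -/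
theorem torus_material_window_le_budget (hd : Fintype.card d = 3) (hν : 0 < ν) (hab : a < b)
    (h : Torus.IsClassicalNSSolutionOn (Icc a b) ν 0 u p)
    (hmean : ∀ t ∈ Icc a b, Torus.HasZeroMean (u t))
    {Y : EuclideanSpace ℝ d → ℝ → EuclideanSpace ℝ d} {φ : ℝ → UnitAddTorus d → UnitAddTorus d}
    (hY0 : ∀ y, Y y a = y)
    (hY : ∀ y, ∀ s ∈ Icc a b, HasDerivWithinAt (Y y) (lift (u s) (Y y s)) (Icc a b) s)
    (hφ : ∀ s ∈ Icc a b, ∀ y, φ s (proj y) = proj (Y y s))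
    (hφmp : ∀ s ∈ Icc a b, MeasurePreserving (φ s) volume volume)
    (Ω₀ : Set (UnitAddTorus d)) {g : UnitAddTorus d → ℝ} (hg : LipschitzWith 1 g) (a' b' : ℝ)
    {t : ℝ} (ht : t ∈ Icc a b) :
    volume (Ω₀ ∩ {x | a' + (fgtRateCoeff ν + fgtConstCoeff * (b - a) +
        fgtGradCoeff ν / ν * Torus.kineticEnergy (u a)) ≤ g x ∧
        g x ≤ b' - (fgtRateCoeff ν + fgtConstCoeff * (b - a) +
        fgtGradCoeff ν / ν * Torus.kineticEnergy (u a))}) ≤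
      volume (φ t '' Ω₀ ∩ {x | a' ≤ g x ∧ g x ≤ b'}) := by
  have hDB : fgtSupPrimitive ν u t - fgtSupPrimitive ν u a ≤
      fgtRateCoeff ν + fgtConstCoeff * (b - a) + fgtGradCoeff ν / ν * Torus.kineticEnergy (u a) :=
    fgtSupPrimitive_sub_le hν ht
  refine le_trans (measure_mono ?_)
    (torus_material_window_le hd hν hab h hmean hY0 hY hφ hφmp Ω₀ hg a' b' ht)
  rintro x ⟨hxΩ, hxa, hxb⟩
  exact ⟨hxΩ, by linarith, by linarith⟩

/-- **Material window inequality on `T³` along Navier–Stokes — packaged with the tree's flow**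
(PROVED, no hypotheses beyond the solution): the Lagrangian flow of a classical mean-zero
solution exists (`Torus.exists_measurePreserving_noisyFlow` with zero noise: Picard–Lindelöf +
Liouville), is volume preserving, moves every particle by at most `P(t) − P(a) ≤
α_ν + β (b − a) + (γ_ν/ν) K(u(a))` (FGT), and therefore satisfies the Córdoba–Fefferman window
inequality for every material region and every `1`-Lipschitz observable — "no squirt / no
material tube collapse" in quantitative form on `T³`.
[Córdoba–Fefferman 2001 §5; Córdoba–Fefferman–de la Llave 2004; Lemarié-Rieusset §11.7 (11.64);
Foias–Guillopé–Temam 1981] -/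
theorem torus_noMaterialCollapse (hd : Fintype.card d = 3) (hν : 0 < ν) (hab : a < b)
    (h : Torus.IsClassicalNSSolutionOn (Icc a b) ν 0 u p)
    (hmean : ∀ t ∈ Icc a b, Torus.HasZeroMean (u t)) :
    ∃ (Y : EuclideanSpace ℝ d → ℝ → EuclideanSpace ℝ d) (φ : ℝ → UnitAddTorus d → UnitAddTorus d),
      (∀ y, Y y a = y) ∧
      (∀ y, ∀ s ∈ Icc a b, HasDerivWithinAt (Y y) (lift (u s) (Y y s)) (Icc a b) s) ∧
      (∀ s ∈ Icc a b, ∀ y, φ s (proj y) = proj (Y y s)) ∧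
      (∀ s ∈ Icc a b, MeasurePreserving (φ s) volume volume) ∧
      (∀ y, ∀ t ∈ Icc a b, ‖Y y t - y‖ ≤
        fgtRateCoeff ν + fgtConstCoeff * (b - a) + fgtGradCoeff ν / ν * Torus.kineticEnergy (u a)) ∧
      (∀ (Ω₀ : Set (UnitAddTorus d)) (g : UnitAddTorus d → ℝ), LipschitzWith 1 g →
        ∀ a' b' : ℝ, ∀ t ∈ Icc a b,
          volume (Ω₀ ∩ {x | a' + (fgtSupPrimitive ν u t - fgtSupPrimitive ν u a) ≤ g x ∧
              g x ≤ b' - (fgtSupPrimitive ν u t - fgtSupPrimitive ν u a)}) ≤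
            volume (φ t '' Ω₀ ∩ {x | a' ≤ g x ∧ g x ≤ b'})) := by
  have ha : a ∈ Icc a b := left_mem_Icc.2 hab.le
  obtain ⟨Y, φ, hY0, hY, -, -, -, hφ, -, hφmp⟩ :=
    Torus.exists_measurePreserving_noisyFlow (w := fun _ => (0 : EuclideanSpace ℝ d)) hab
      h.smooth_velocity h.divFree continuousOn_const ha
  simp only [sub_self, add_zero] at hY hφ
  refine ⟨Y, φ, hY0, hY, hφ, hφmp, fun y t ht => ?_, fun Ω₀ g hg a' b' t ht =>
    torus_material_window_le hd hν hab h hmean hY0 hY hφ hφmp Ω₀ hg a' b' ht⟩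
  have := material_displacement_le_fgt_budget hd hν hab h hmean (hY y)
    (fun s _ => ⟨proj (Y y s), le_rfl⟩) ht
  rwa [hY0 y] at this

end TorusMaterial

end Summit.NavierStokesRegularity.FluidComputer.MaterialDisplacement
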